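import Summits.QuantumAdvantage.QuantumAdvantage.Theorems.PerceptronDialLawsB

/-! # PerceptronDialLawsC — part 3/4 (mechanical split for landing of `PerceptronDialLaws`; content verbatim; scopes re-opened with their variables) -/

set_option linter.dupNamespace false
noncomputable section

namespace Summit.QuantumAdvantage.QuantumAdvantage.Theorems.PerceptronDial
open Finset
open Literature.Computability.Complexity
open Literature.Computability.QuantumComplexity
open Literature.Computability.QuantumComplexity.BuzetChailloux (bxor zeroVec)
open Summit.QuantumAdvantage.QuantumAdvantage.Theses.AnfPresentation
open Summit.QuantumAdvantage.QuantumAdvantage.Theorems.HintDial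
open Summit.QuantumAdvantage.QuantumAdvantage.Theorems.HintDial.Automaton
open Summit.QuantumAdvantage.QuantumAdvantage.Theorems.HintDial (bit_xor bit_and bit_not bit_eq_ite bit_decide_odd bit_injective bit_mul_self bit_false eval_bit)
open CubicForm (bit)
open DerivativeWalsh (W)
open Summit.QuantumAdvantage.QuantumAdvantage.Theorems.PebbleDial (AnfIdx bitsFG bits)
variable {n k : ℕ}

/-- ★★★ [THE DISCRIMINATOR EDGE, kernel] a quadratic-vote-hard face inside the slice proves `VoteRung2NU` (hence `VoteRung2`). -/
theorem voteRung2NU_of_face {Ω : ℕ → Type} [∀ m, Fintype (Ω m)] (Φ : QFace Ω) (h : Φ.QuadUncorrelated) : VoteRung2NU := by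
  classical
  rw [voteRung2NU_iff]
  rintro C ⟨p, hp⟩ hS
  obtain ⟨m, hm⟩ := h p
  have hr : (C (Φ.arity m)).size ≤ p.eval (Φ.arity m) := hp _
  have hcard : (0 : ℝ) < Fintype.card (Ω m) := by
    haveI := Φ.nonempty m
    exact_mod_cast Fintype.card_pos
  -- pointwise: YES parameters vote `≥ 1`, NO parameters vote `≤ 0`
  have hpt : ∀ w, (if Φ.sgn m w = false then (1 : ℝ) else 0)
      ≤ signOf (Φ.sgn m w) * (C (Φ.arity m)).val (Φ.tbits m w) := by
    intro w
    have hw := hS (Φ.inst m w) (Φ.even m)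
    have hv : (Φ.inst m w).value = signOf (Φ.sgn m w) := Φ.value_eq m w
    rw [hv] at hw
    cases hsg : Φ.sgn m w
    · have hacc : 0 < (C (Φ.arity m)).val (Φ.tbits m w) := hw.1 (by rw [hsg]; rfl)
      have h1 := (C (Φ.arity m)).one_le_val_of_pos _ hacc
      simp only [if_true, signOf, Bool.false_eq_true, if_false, one_mul]
      exact h1
    · have hrej : ¬ 0 < (C (Φ.arity m)).val (Φ.tbits m w) := hw.2 (by rw [hsg]; simp [signOf])
      simp only [Bool.true_eq_false, if_false, signOf, if_true]
      linarith [not_lt.1 hrej]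
  -- summing: at least `#YES ≥ |Ω| / 2`
  have hlow : (Fintype.card (Ω m) : ℝ) / 2 ≤ ∑ w, signOf (Φ.sgn m w) * (C (Φ.arity m)).val (Φ.tbits m w) := by
    have hb : (Fintype.card (Ω m) : ℝ) ≤ 2 * ((univ.filter fun w => Φ.sgn m w = false).card : ℝ) := by
      exact_mod_cast Φ.balanced m
    have hc : ((univ.filter fun w => Φ.sgn m w = false).card : ℝ)
        = ∑ w : Ω m, (if Φ.sgn m w = false then (1 : ℝ) else 0) := by
      rw [Finset.sum_boole]
    calc (Fintype.card (Ω m) : ℝ) / 2 ≤ ((univ.filter fun w => Φ.sgn m w = false).card : ℝ) := by linarith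
      _ = _ := hc
      _ ≤ _ := sum_le_sum fun w _ => hpt w
  -- exchanging the sums: the total signed vote is the sum of the gates' correlations
  have hswap : ∑ w, signOf (Φ.sgn m w) * (C (Φ.arity m)).val (Φ.tbits m w)
      = ∑ i, Φ.corr m ((C (Φ.arity m)).cst i) ((C (Φ.arity m)).mono i) := by
    simp only [MajQuadCkt.val, QFace.corr, mul_sum]
    rw [sum_comm]
  -- but every correlation is `< |Ω| / (2 p(n))` and there are `≤ p(n)` gates
  have hup : ∑ i, Φ.corr m ((C (Φ.arity m)).cst i) ((C (Φ.arity m)).mono i) < (Fintype.card (Ω m) : ℝ) / 2 := by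
    by_cases hr0 : (C (Φ.arity m)).size = 0
    · have hz : ∑ i, Φ.corr m ((C (Φ.arity m)).cst i) ((C (Φ.arity m)).mono i) = 0 := by
        apply Finset.sum_eq_zero
        intro i _
        exact absurd i.2 (by omega)
      rw [hz]
      positivity
    · have hp0 : (0 : ℝ) < p.eval (Φ.arity m) := by
        exact_mod_cast (Nat.pos_of_ne_zero hr0).trans_le hr
      have heach : ∀ i, Φ.corr m ((C (Φ.arity m)).cst i) ((C (Φ.arity m)).mono i)
          < (Fintype.card (Ω m) : ℝ) / (2 * p.eval (Φ.arity m)) := fun i => by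
        have h2 := hm ((C (Φ.arity m)).cst i) ((C (Φ.arity m)).mono i)
        have habs := le_abs_self (Φ.corr m ((C (Φ.arity m)).cst i) ((C (Φ.arity m)).mono i))
        have h3 : Φ.corr m ((C (Φ.arity m)).cst i) ((C (Φ.arity m)).mono i) * (2 * ((p.eval (Φ.arity m) : ℕ) : ℝ))
            ≤ |Φ.corr m ((C (Φ.arity m)).cst i) ((C (Φ.arity m)).mono i)| * (2 * ((p.eval (Φ.arity m) : ℕ) : ℝ)) :=
          mul_le_mul_of_nonneg_right habs (by positivity)
        rw [lt_div_iff₀ (by positivity)]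
        linarith
      have hne : (univ : Finset (Fin (C (Φ.arity m)).size)).Nonempty :=
        ⟨⟨0, Nat.pos_of_ne_zero hr0⟩, mem_univ _⟩
      calc ∑ i, Φ.corr m ((C (Φ.arity m)).cst i) ((C (Φ.arity m)).mono i)
          < ∑ _i : Fin (C (Φ.arity m)).size, (Fintype.card (Ω m) : ℝ) / (2 * p.eval (Φ.arity m)) :=
            sum_lt_sum_of_nonempty hne fun i _ => heach i
        _ = (C (Φ.arity m)).size * ((Fintype.card (Ω m) : ℝ) / (2 * p.eval (Φ.arity m))) := by simp
        _ ≤ ((p.eval (Φ.arity m) : ℕ) : ℝ) * ((Fintype.card (Ω m) : ℝ) / (2 * p.eval (Φ.arity m))) := by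
            gcongr
        _ = (Fintype.card (Ω m) : ℝ) / 2 := by field_simp
  rw [hswap] at hlow
  linarith

/-- [edge, uniform form] -/
theorem voteRung2_of_face {Ω : ℕ → Type} [∀ m, Fintype (Ω m)] (Φ : QFace Ω) (h : Φ.QuadUncorrelated) : VoteRung2 :=
  voteRung2_of_voteRung2NU (voteRung2NU_of_face Φ h)

/-! ## §8 The quadratic-key face: a Maiorana–McFarland planting OUTSIDE the separated linear-key class

The leak law of HintDial g6 (`leak_level1`) says every separated LINEAR-key planting `blTable` has a sign that is a quadratic phase
of its table bits — so no such face can be quadratic-vote-hard (the IP face of §4 is the extreme case).  The way out named in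
TREE §planting-law is a QUADRATIC KEY: `F_{s,t,B}(x′,x″) = ⟨s,x′⟩ ⊕ ⟨x′,x″⟩ ⊕ ⟨t,x″⟩ ⊕ Q_B(x″)` with `Q_B(x″) = ⊕_{a<a'} B_{aa'} x″_a x″_{a'}`.
We build its table, compute its Walsh transform and its dual (kernel), and obtain the first EXACT quadratic-key family of the
lineage; its label `b ⊕ [Q_B(s) ⊕ ⟨t,s⟩]` involves the VALUE OF THE KEY FORM AT THE SHIFT, which no quadratic phase of the visible
bits `(s, t, B, (B+Bᵀ)s ⊕ t)` is known to capture — `KeyBias` below is exactly the statement that none does, with polynomial margin. -/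

section QKey

variable {k : ℕ}

/-- strictly upper-triangular truncation of a key pattern -/
def ut (B : Fin k → Fin k → Bool) : Fin k → Fin k → Bool := fun a a' => decide (a < a') && B a a'

/-- transpose of a pattern -/
def tr (U : Fin k → Fin k → Bool) : Fin k → Fin k → Bool := fun a a' => U a' a

/-- the zero pattern -/
def zm : Fin k → Fin k → Bool := fun _ _ => false

/-- ★ the quadratic form of key `B`: `Q_B(x) = ⊕_{a<a'} B_{aa'} x_a x_{a'} = ⟨x, U_B x⟩`. -/
def qf (B : Fin k → Fin k → Bool) (x : Fin k → Bool) : Bool := bd x (mv (ut B) x)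

/-- its polar map `s ↦ (U_B + U_Bᵀ) s` (an alternating bilinear form: `⟨s, polar B s⟩ = 0`). -/
def polar (B : Fin k → Fin k → Bool) (s : Fin k → Bool) : Fin k → Bool := bxor (mv (ut B) s) (mv (tr (ut B)) s)

/-- PerceptronDialLawsC helper `bd_mv_tr` (decomp-qadv land package; see the module docstring). -/
theorem bd_mv_tr (U : Fin k → Fin k → Bool) (s y : Fin k → Bool) : bd s (mv U y) = bd y (mv (tr U) s) := by
  apply bit_injective
  simp only [bit_bd, mv, tr, mul_sum]
  rw [sum_comm]
  exact sum_congr rfl fun a _ => sum_congr rfl fun a' _ => by ring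

/-- ★ [polarisation] `Q_B(s ⊕ y) = Q_B(s) ⊕ Q_B(y) ⊕ ⟨y, polar_B s⟩`. -/
theorem qf_bxor (B : Fin k → Fin k → Bool) (s y : Fin k → Bool) :
    qf B (bxor s y) = xor (xor (qf B s) (qf B y)) (bd y (polar B s)) := by
  unfold qf polar
  rw [mv_bxor, bd_bxor_left, bd_bxor_right, bd_bxor_right, bd_bxor_right, bd_mv_tr (ut B) s y]
  generalize bd s (mv (ut B) s) = P
  generalize bd y (mv (tr (ut B)) s) = Q
  generalize bd y (mv (ut B) s) = R
  generalize bd y (mv (ut B) y) = T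
  cases P <;> cases Q <;> cases R <;> cases T <;> rfl

/-- PerceptronDialLawsC helper `qf_zm` (decomp-qadv land package; see the module docstring). -/
theorem qf_zm (x : Fin k → Bool) : qf zm x = false := by
  have h : mv (ut zm) x = zeroVec := funext fun a => by simp [mv, ut, zm, bd, zeroVec]
  rw [qf, h]
  exact bd_zeroVec_right x

/-- the key pattern of a two-sided table WITH QUADRATIC BLOCKS: `(x′x′)`-block `diag(α) + U_A`, `(x′x″)`-block `M`, `(x″x″)`-block
`diag(β) + U_B`. -/
def QP (α : Fin k → Bool) (A : Fin k → Fin k → Bool) (M : Fin k → Fin k → Bool) (β : Fin k → Bool)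
    (B : Fin k → Fin k → Bool) : Fin k ⊕ Fin k → Fin k ⊕ Fin k → Bool
  | .inl a, .inl a' => xor (decide (a = a') && α a) (ut A a a')
  | .inl a, .inr b => M a b
  | .inr _, .inl _ => false
  | .inr b, .inr b' => xor (decide (b = b') && β b) (ut B b b')

/-- a cubic table supported on the `i = j` diagonal with pattern `P` (so it presents the quadratic function `x ↦ c ⊕ xᵀ P x`). -/
def diagTable (k : ℕ) (c : Bool) (P : Fin k ⊕ Fin k → Fin k ⊕ Fin k → Bool) : CubicForm (k + k) :=
  ⟨c, fun i j l => decide (i = j) && P (finSumFinEquiv.symm i) (finSumFinEquiv.symm l)⟩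

/-- ★ the quadratic-key table `F(x′,x″) = c ⊕ ⟨α,x′⟩ ⊕ Q_A(x′) ⊕ ⟨x′, M x″⟩ ⊕ ⟨β,x″⟩ ⊕ Q_B(x″)`. -/
def qTable (k : ℕ) (c : Bool) (α : Fin k → Bool) (A : Fin k → Fin k → Bool) (M : Fin k → Fin k → Bool) (β : Fin k → Bool)
    (B : Fin k → Fin k → Bool) : CubicForm (k + k) :=
  diagTable k c (QP α A M β B)

/-- bit semantics of a diagonal table -/
theorem bit_eval_diag (c : Bool) (P : Fin k ⊕ Fin k → Fin k ⊕ Fin k → Bool) (x₁ x₂ : Fin k → Bool) :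
    bit ((diagTable k c P).eval (Fin.append x₁ x₂)) = bit c
      + ((∑ a, ∑ a', bit (P (.inl a) (.inl a')) * (bit (x₁ a) * bit (x₁ a'))
          + ∑ a, ∑ b, bit (P (.inl a) (.inr b)) * (bit (x₁ a) * bit (x₂ b)))
        + (∑ b, ∑ a, bit (P (.inr b) (.inl a)) * (bit (x₂ b) * bit (x₁ a))
          + ∑ b, ∑ b', bit (P (.inr b) (.inr b')) * (bit (x₂ b) * bit (x₂ b')))) := by
  rw [eval_bit]
  set x := Fin.append x₁ x₂ with hx
  have hj : ∀ i l : Fin (k + k), ∑ j, bit ((diagTable k c P).cube i j l) * (bit (x i) * bit (x j) * bit (x l))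
      = bit (P (finSumFinEquiv.symm i) (finSumFinEquiv.symm l)) * (bit (x i) * bit (x l)) := by
    intro i l
    rw [Finset.sum_eq_single i]
    · simp only [diagTable, decide_true, Bool.true_and, bit_mul_self]
    · intro j _ hji
      simp only [diagTable, decide_eq_false (Ne.symm hji), Bool.false_and]
      simp [bit]
    · simp
  have h1 : ∑ i, ∑ j, ∑ l, bit ((diagTable k c P).cube i j l) * (bit (x i) * bit (x j) * bit (x l))
      = ∑ i : Fin (k + k), ∑ l : Fin (k + k),
          bit (P (finSumFinEquiv.symm i) (finSumFinEquiv.symm l)) * (bit (x i) * bit (x l)) :=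
    sum_congr rfl fun i _ => by rw [sum_comm]; exact sum_congr rfl fun l _ => hj i l
  rw [h1, Fin.sum_univ_add]
  simp_rw [Fin.sum_univ_add, hx, finSumFinEquiv_symm_apply_castAdd, finSumFinEquiv_symm_apply_natAdd, Fin.append_left,
    Fin.append_right]
  rw [show (diagTable k c P).const = c from rfl]
  simp only [sum_add_distrib]

/-- PerceptronDialLawsC helper `bit_qf` (decomp-qadv land package; see the module docstring). -/
theorem bit_qf (B : Fin k → Fin k → Bool) (x : Fin k → Bool) :
    bit (qf B x) = ∑ a, ∑ a', bit (ut B a a') * (bit (x a) * bit (x a')) := by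
  simp only [qf, bit_bd, mv, mul_sum]
  exact sum_congr rfl fun a _ => sum_congr rfl fun a' _ => by ring

/-- ★ Boolean semantics of the quadratic-key table. -/
theorem eval_qTable (c : Bool) (α : Fin k → Bool) (A M : Fin k → Fin k → Bool) (β : Fin k → Bool) (B : Fin k → Fin k → Bool)
    (x₁ x₂ : Fin k → Bool) :
    (qTable k c α A M β B).eval (Fin.append x₁ x₂)
      = xor (xor (xor (xor (xor c (bd α x₁)) (qf A x₁)) (bd x₁ (mv M x₂))) (bd β x₂)) (qf B x₂) := by
  apply bit_injective
  rw [qTable, bit_eval_diag]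
  simp only [bit_xor, bit_qf, bit_bd, QP, bit_decide_and, bit_false, zero_mul, sum_const_zero, zero_add, add_mul,
    sum_add_distrib, ite_mul, Finset.sum_ite_eq, Finset.mem_univ, if_true, bit_mul_self, mv, mul_sum]
  have e : ∀ a b : Fin k, bit (M a b) * (bit (x₁ a) * bit (x₂ b)) = bit (x₁ a) * (bit (M a b) * bit (x₂ b)) := fun a b => by ring
  simp only [e]
  ring

/-- ★ the F-side of the face: `F_{c,α,M,β,B}(x′,x″) = c ⊕ ⟨α,x′⟩ ⊕ ⟨x′,Mx″⟩ ⊕ ⟨β,x″⟩ ⊕ Q_B(x″)` (quadratic key on the `x″` half only,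
so that `F` is Maiorana–McFarland bent for invertible `M`). -/
def qF (k : ℕ) (c : Bool) (α : Fin k → Bool) (M : Fin k → Fin k → Bool) (β : Fin k → Bool) (B : Fin k → Fin k → Bool) :
    CubicForm (k + k) :=
  qTable k c α zm M β B

/-- PerceptronDialLawsC helper `eval_qF` (decomp-qadv land package; see the module docstring). -/
theorem eval_qF (c : Bool) (α : Fin k → Bool) (M : Fin k → Fin k → Bool) (β : Fin k → Bool) (B : Fin k → Fin k → Bool)
    (x₁ x₂ : Fin k → Bool) :
    (qF k c α M β B).eval (Fin.append x₁ x₂) = xor (xor (xor (xor c (bd α x₁)) (bd x₁ (mv M x₂))) (bd β x₂)) (qf B x₂) := by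
  rw [qF, eval_qTable, qf_zm]
  generalize bd α x₁ = P; generalize bd x₁ (mv M x₂) = Q; generalize bd β x₂ = R; generalize qf B x₂ = T
  cases c <;> cases P <;> cases Q <;> cases R <;> cases T <;> rfl

variable {c : Bool} {α β : Fin k → Bool} {M N B : Fin k → Fin k → Bool}

/-- ★ THE WALSH TRANSFORM of the quadratic-key table: `W_F(y′,y″) = 2^k · (-1)^{c ⊕ ⟨β,u⟩ ⊕ Q_B(u) ⊕ ⟨u,y″⟩}`, `u = N(α ⊕ y′)`. -/
theorem W_qF (hN : ∀ x, mv M (mv N x) = x) (y₁ y₂ : Fin k → Bool) :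
    W (fun x => signOf ((qF k c α M β B).eval x)) (Fin.append y₁ y₂)
      = 2 ^ k * (signOf c * twist β (mv N (bxor α y₁)) * signOf (qf B (mv N (bxor α y₁))) * twist (mv N (bxor α y₁)) y₂) := by
  rw [DerivativeWalsh.W, sum_append]
  simp_rw [eval_qF, twist_append, signOf_xor, signOf_bd]
  rw [sum_comm]
  have inner : ∀ x₂ : Fin k → Bool,
      ∑ x₁ : Fin k → Bool, signOf c * twist α x₁ * twist x₁ (mv M x₂) * twist β x₂ * signOf (qf B x₂) * (twist x₁ y₁ * twist x₂ y₂)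
        = (signOf c * twist β x₂ * signOf (qf B x₂) * twist x₂ y₂) * (if x₂ = mv N (bxor α y₁) then (2 : ℝ) ^ k else 0) := by
    intro x₂
    have e : ∀ x₁ : Fin k → Bool,
        signOf c * twist α x₁ * twist x₁ (mv M x₂) * twist β x₂ * signOf (qf B x₂) * (twist x₁ y₁ * twist x₂ y₂)
          = (signOf c * twist β x₂ * signOf (qf B x₂) * twist x₂ y₂) * twist x₁ (bxor (bxor α (mv M x₂)) y₁) := fun x₁ => by
      rw [BuzetChailloux.twist_bxor_right, BuzetChailloux.twist_bxor_right, twist_comm α x₁]; ring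
    simp_rw [e]
    rw [← mul_sum, BuzetChailloux.sum_twist_left]
    simp only [BuzetChailloux.bxor_eq_zeroVec_iff]
    simp only [bxor_left_eq_iff', mv_eq_iff hN]
  simp_rw [inner, mul_ite, mul_zero, Finset.sum_ite_eq', Finset.mem_univ, if_true]
  ring

/-- ★ the Maiorana–McFarland dual of the quadratic-key table: `F̃(y′,y″) = c ⊕ ⟨β,u⟩ ⊕ Q_B(u) ⊕ ⟨u,y″⟩`, `u = N(α ⊕ y′)`. -/
def dualQ (c : Bool) (α : Fin k → Bool) (N : Fin k → Fin k → Bool) (β : Fin k → Bool) (B : Fin k → Fin k → Bool)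
    (y : Fin (k + k) → Bool) : Bool :=
  xor (xor (xor c (bd β (mv N (bxor α fun i => y (Fin.castAdd k i))))) (qf B (mv N (bxor α fun i => y (Fin.castAdd k i)))))
    (bd (mv N (bxor α fun i => y (Fin.castAdd k i))) fun i => y (Fin.natAdd k i))

/-- PerceptronDialLawsC helper `dualQ_append` (decomp-qadv land package; see the module docstring). -/
theorem dualQ_append (y₁ y₂ : Fin k → Bool) :
    dualQ c α N β B (Fin.append y₁ y₂)
      = xor (xor (xor c (bd β (mv N (bxor α y₁)))) (qf B (mv N (bxor α y₁)))) (bd (mv N (bxor α y₁)) y₂) := by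
  simp only [dualQ, Fin.append_left, Fin.append_right]

/-- ★★ `dualQ` IS the dual of the quadratic-key table. -/
theorem isDualOf_qF (hN : ∀ x, mv M (mv N x) = x) : IsDualOf (qF k c α M β B).eval (dualQ c α N β B) := by
  intro y
  obtain ⟨⟨y₁, y₂⟩, rfl⟩ := (Fin.appendEquiv k k).surjective y
  show W _ (Fin.append y₁ y₂) = _ * signOf (dualQ c α N β B (Fin.append y₁ y₂))
  rw [W_qF hN, dualQ_append]
  simp only [signOf_xor, signOf_bd]
  rw [SgnForrMem.sqrt_two_pow_add_self]


end QKey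
end Summit.QuantumAdvantage.QuantumAdvantage.Theorems.PerceptronDial
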